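import Literature.IUT.LogThetaLattice.BiCoresOfKitsWithRealifiedD
import Literature.IUT.LogThetaLattice.LatticeGlueTransportedUnitPortion
import HarnessLib

/-!
# `LatticeGlueKit.withRealifiedD`: the canonical companion glue of a kit-level glue datum is KUMMER-COHERENT and satisfies
# [IUTchIII] Thm 1.5 (v) — the two [IUTchIII] §1–§2 rows of `Layer6ResidualB` as theorems (sequel of `BiCoresOfKitsWithRealifiedD`)

Mochizuki, *Inter-universal Teichmüller Theory III*, kurims manuscript (May 2020), §1 Thm 1.5 (v) pp.50–51, §2 Prop 2.1 (vi)
pp.60–61, Cor 2.3 (i) p.72; *II* (Dec 2020) Cor 4.5 (ii) p.132, Cor 4.6 (ii) p.133, Cor 4.10 (iv)(v) pp.160–161.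
[claim: Mochizuki2012, status: disputed] (D-0012 claim key). abc-iut cell, seat abc-iut-w4-d005 (gen 4), row «BiCoricKit.withRealifiedD»
(zone owner abc-iut-L6-t3 g5's offer 2026-08-26T08:15:03Z), glue-level half. ONE definition (`LatticeGlueKit.withRealifiedD`, post-freeze
def, reading (ii)) + theorems; consumed BY NAME: abc-iut-L6-t3 `LatticeGlueKit` / `LatticeGlue.ofKits` / `transportUnitPortion` /
`transportUnitPortion_kummerCoherent_of_full` / `KummerCoherent` (p431830, LatticeGlueKummerCoherent), this seat's
`BiCoricKit.withRealifiedD` / `ofKits_withRealifiedD_realifiedKummer_eq_full` / `thm15vSingleIso_ofKits_withRealifiedD`.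

WHAT THIS FILE DOES. For ANY kit-level glue datum `Gk : LatticeGlueKit hR X` and any choice of the [IUTchII] Cor 4.5 (ii) object-level
inputs `(line, c, hc)`: `Gk.withRealifiedD line c hc` replaces only the bi-coric kit by its companion `Gk.biCoricKit.withRealifiedD …`
(the log / link / theta-monoid / coric kits and the eight identifications are untouched — none involves the realified slot); then
**`ofKits_withRealifiedD_transportUnitPortion_kummerCoherent`**: the real-frame glue `(LatticeGlue.ofKits … (Gk.withRealifiedD …)).transportUnitPortion`
(abc-iut-L6-t3's transported [IUTchII] Cor 4.10 (iv) unit-portion identification) is `KummerCoherent` with NO hypothesis, and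
**`thm15vSingleIso_glue_withRealifiedD`** / **`realifiedRigidAt_glue_withRealifiedD`**: its bi-coric data satisfy Thm 1.5 (v)'s
single-isomorphism clause and the consumers' rigidity hypothesis, with NO hypothesis; `exists_kummerCoherent_companion` packages it.

HONEST SCOPE: the companion is a canonical CHOICE of the realified slot and of the Cor 4.10 (iv) identification (both disclosed in the
parent files); which data the GENUINE kits carry remains abc-iut-L6-t2's / abc-iut-L5's input BY NAME. Nothing here takes a side on
[IUTchIII] Cor. 3.12; typed ≠ proved; instantiated ≠ endorsed.
-/

noncomputable section

namespace Literature.IUT.LogThetaLattice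

open CategoryTheory
open Literature.IUT.HodgeTheaters Literature.IUT.HodgeTheaters.PMBaseKit Literature.IUT.HodgeArakelov
open Literature.AnabelianGeometry.AbsoluteAnabelian AsSmallTransport

universe u

variable {l : ℕ} {K : PMBaseKit.{u} l} {M : K.MultKit} {FK : K.FKit M} {L : FK.MonoLaws}

/-! ### 3. Glue level: the companion glue is Kummer-coherent and satisfies Thm 1.5 (v) -/

namespace LatticeGlueKit

variable {hR : FK.RlfOfIsStrip} {X : TimesMuSide FK L} (Gk : LatticeGlueKit hR X)
  (line : M.DMono → K.V → RLine.{u}) (c : K.V → ℝ) (hc : ∀ v, 0 < c v)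

/-- **IUTchIII:Cor2.3(i)** (kurims p.72) the kit-level glue datum with its bi-coric kit replaced by the companion
`Gk.biCoricKit.withRealifiedD line c hc`; the log / link / theta-monoid / coric kits and the eight identifications are UNCHANGED
(none of them involves the realified slot). [claim: Mochizuki2012, status: disputed] -/
def withRealifiedD : LatticeGlueKit hR X :=
  { Gk with biCoricKit := Gk.biCoricKit.withRealifiedD line c hc }

/-- The companion's bi-coric kit. [claim: Mochizuki2012, status: disputed] -/
@[simp] theorem withRealifiedD_biCoricKit :
    (Gk.withRealifiedD line c hc).biCoricKit = Gk.biCoricKit.withRealifiedD line c hc := rfl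

/-- Unchanged: the link kit. [claim: Mochizuki2012, status: disputed] -/
@[simp] theorem withRealifiedD_linkKit : (Gk.withRealifiedD line c hc).linkKit = Gk.linkKit := rfl

/-- Unchanged: the theta-monoid kit. [claim: Mochizuki2012, status: disputed] -/
@[simp] theorem withRealifiedD_thetaMonoidKit : (Gk.withRealifiedD line c hc).thetaMonoidKit = Gk.thetaMonoidKit := rfl

end LatticeGlueKit

section Glue

variable (L) (hbij : FK.IsomFtoDBijective) (hsurj : FK.IsomFmtoDmSurjective) (hR : FK.RlfOfIsStrip)
  (X : TimesMuSide FK L)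
  (h : ∀ A B : X.Fglxm, Function.Surjective (fun g : A ≅ B => (X.FglxmToFvtxm ⋙ X.FvtxmToFxm).mapIso g))
  (Gk : LatticeGlueKit hR X)
  (line : M.DMono → K.V → RLine.{u}) (c : K.V → ℝ) (hc : ∀ v, 0 < c v)

/-- **IUTchIII:Prop2.1(vi)** (kurims p.61) + **IUTchIII:Thm1.5(v)** (p.51) — **the canonical companion glue is KUMMER-COHERENT with NO
hypothesis**: for EVERY kit-level glue datum `Gk` and every choice of the Cor 4.5 (ii) object-level inputs, the real-frame glue
assembled from `Gk.withRealifiedD line c hc`, with abc-iut-L6-t3's transported [IUTchII] Cor 4.10 (iv) unit-portion identification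
(p431830), satisfies the owner's successor predicate `LatticeGlue.KummerCoherent` (GAP rows G-w4d026-1 / G-w4d026-2): the Prop 2.1 (vi) square by
`transportUnitPortion_kummerSquare`, the `ℝ_{>0}`-orbit law because the companion's orbits are full.
[claim: Mochizuki2012, status: disputed] -/
theorem ofKits_withRealifiedD_transportUnitPortion_kummerCoherent :
    (LatticeGlue.ofKits L hbij hsurj hR X h (Gk.withRealifiedD line c hc)).transportUnitPortion.KummerCoherent :=
  (LatticeGlue.ofKits L hbij hsurj hR X h (Gk.withRealifiedD line c hc)).transportUnitPortion_kummerCoherent_of_full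
    (ofKits_withRealifiedD_realifiedKummer_eq_full L hbij hsurj hR X Gk.biCoricKit line c hc)

/-- **IUTchIII:Thm1.5(v)** (kurims p.50) the bi-coric data of the companion glue (before or after transporting the unit portion — the bi-coric
field is the same, `transportUnitPortion_biCoric`) satisfy `Thm15vSingleIso` with NO hypothesis. [claim: Mochizuki2012, status: disputed] -/
theorem thm15vSingleIso_glue_withRealifiedD :
    (LatticeGlue.ofKits L hbij hsurj hR X h (Gk.withRealifiedD line c hc)).transportUnitPortion.biCoric.Thm15vSingleIso :=
  thm15vSingleIso_ofKits_withRealifiedD L hbij hsurj hR X Gk.biCoricKit line c hc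

/-- **IUTchII:Cor4.10(v)** (kurims p.160) … and `RealifiedRigidAt` at every pair of `𝒟^⊢`-prime-strips (the consumer hypothesis of the
Cor 3.12 crew's `Thm311.LinkData.ofGlue` consumers, F-2066's shape), with NO hypothesis. [claim: Mochizuki2012, status: disputed] -/
theorem realifiedRigidAt_glue_withRealifiedD (A B : (StripFrame.ofKits L hbij hsurj hR X).Dv) :
    (LatticeGlue.ofKits L hbij hsurj hR X h (Gk.withRealifiedD line c hc)).transportUnitPortion.biCoric.RealifiedRigidAt A B :=
  realifiedRigidAt_ofKits_withRealifiedD L hbij hsurj hR X Gk.biCoricKit line c hc A B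

include line c hc in
/-- **IUTchIII:Prop2.1(vi)** + **Thm1.5(v)** (kurims pp.50–51, 61), packaged: every kit-level glue datum admits a canonical companion glue
over the same real frame — same log-links, pilots, theta monoids, coric data, shells, Kummer isomorphisms of Thm 1.5 (iii) — that is
Kummer-coherent AND satisfies Thm 1.5 (v)'s single-isomorphism clause, both with no hypothesis.
[claim: Mochizuki2012, status: disputed] -/
theorem exists_kummerCoherent_companion :
    ∃ G : LatticeGlue (StripFrame.ofKits L hbij hsurj hR X),
      G.KummerCoherent ∧ G.biCoric.Thm15vSingleIso ∧
        G.logData = (LatticeGlue.ofKits L hbij hsurj hR X h Gk).logData ∧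
        G.thetaMonoid = (LatticeGlue.ofKits L hbij hsurj hR X h Gk).thetaMonoid ∧
        G.coric = (LatticeGlue.ofKits L hbij hsurj hR X h Gk).coric :=
  ⟨(LatticeGlue.ofKits L hbij hsurj hR X h (Gk.withRealifiedD line c hc)).transportUnitPortion,
    ofKits_withRealifiedD_transportUnitPortion_kummerCoherent L hbij hsurj hR X h Gk line c hc,
    thm15vSingleIso_glue_withRealifiedD L hbij hsurj hR X h Gk line c hc, rfl, rfl, rfl⟩

end Glue

end Literature.IUT.LogThetaLattice

end
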